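import Literature.NumberTheory.LFunctions.WeilTwoPrimeDeflM72YDef
import Literature.NumberTheory.LFunctions.WeilTwoPrimeDeflM72YDataPO23
import Literature.NumberTheory.LFunctions.WeilBlockRowsR
import HarnessLib

/-!
# Deflated two-prime certificate M72Y: the materialized odd block agrees with `P_r + Σ μ ĉ ĉᵀ`, rows 80–89

`WeilCert.checkPmRowG` for certificate M72Y (odd block), by `decide +kernel`. Pure proof file; nothing is asserted.
-/

noncomputable section

namespace Literature.NumberTheory.LFunctions

set_option maxHeartbeats 0 in
/-- Row 80 of the materialized odd block is row 80 of `P_r + Σ μ ĉ ĉᵀ` (certificate M72Y). [folklore] -/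
theorem checkPmRowG1_80_weilCertDeflM72Y : weilCertDeflM72YBase.checkPmRowG weilCertDeflM72YP weilCertDeflM72YPmO 1 80 = true := by
  decide +kernel

set_option maxHeartbeats 0 in
/-- Row 81 of the materialized odd block is row 81 of `P_r + Σ μ ĉ ĉᵀ` (certificate M72Y). [folklore] -/
theorem checkPmRowG1_81_weilCertDeflM72Y : weilCertDeflM72YBase.checkPmRowG weilCertDeflM72YP weilCertDeflM72YPmO 1 81 = true := by
  decide +kernel

set_option maxHeartbeats 0 in
/-- Row 82 of the materialized odd block is row 82 of `P_r + Σ μ ĉ ĉᵀ` (certificate M72Y). [folklore] -/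
theorem checkPmRowG1_82_weilCertDeflM72Y : weilCertDeflM72YBase.checkPmRowG weilCertDeflM72YP weilCertDeflM72YPmO 1 82 = true := by
  decide +kernel

set_option maxHeartbeats 0 in
/-- Row 83 of the materialized odd block is row 83 of `P_r + Σ μ ĉ ĉᵀ` (certificate M72Y). [folklore] -/
theorem checkPmRowG1_83_weilCertDeflM72Y : weilCertDeflM72YBase.checkPmRowG weilCertDeflM72YP weilCertDeflM72YPmO 1 83 = true := by
  decide +kernel

set_option maxHeartbeats 0 in
/-- Row 84 of the materialized odd block is row 84 of `P_r + Σ μ ĉ ĉᵀ` (certificate M72Y). [folklore] -/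
theorem checkPmRowG1_84_weilCertDeflM72Y : weilCertDeflM72YBase.checkPmRowG weilCertDeflM72YP weilCertDeflM72YPmO 1 84 = true := by
  decide +kernel

set_option maxHeartbeats 0 in
/-- Row 85 of the materialized odd block is row 85 of `P_r + Σ μ ĉ ĉᵀ` (certificate M72Y). [folklore] -/
theorem checkPmRowG1_85_weilCertDeflM72Y : weilCertDeflM72YBase.checkPmRowG weilCertDeflM72YP weilCertDeflM72YPmO 1 85 = true := by
  decide +kernel

set_option maxHeartbeats 0 in
/-- Row 86 of the materialized odd block is row 86 of `P_r + Σ μ ĉ ĉᵀ` (certificate M72Y). [folklore] -/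
theorem checkPmRowG1_86_weilCertDeflM72Y : weilCertDeflM72YBase.checkPmRowG weilCertDeflM72YP weilCertDeflM72YPmO 1 86 = true := by
  decide +kernel

set_option maxHeartbeats 0 in
/-- Row 87 of the materialized odd block is row 87 of `P_r + Σ μ ĉ ĉᵀ` (certificate M72Y). [folklore] -/
theorem checkPmRowG1_87_weilCertDeflM72Y : weilCertDeflM72YBase.checkPmRowG weilCertDeflM72YP weilCertDeflM72YPmO 1 87 = true := by
  decide +kernel

set_option maxHeartbeats 0 in
/-- Row 88 of the materialized odd block is row 88 of `P_r + Σ μ ĉ ĉᵀ` (certificate M72Y). [folklore] -/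
theorem checkPmRowG1_88_weilCertDeflM72Y : weilCertDeflM72YBase.checkPmRowG weilCertDeflM72YP weilCertDeflM72YPmO 1 88 = true := by
  decide +kernel

set_option maxHeartbeats 0 in
/-- Row 89 of the materialized odd block is row 89 of `P_r + Σ μ ĉ ĉᵀ` (certificate M72Y). [folklore] -/
theorem checkPmRowG1_89_weilCertDeflM72Y : weilCertDeflM72YBase.checkPmRowG weilCertDeflM72YP weilCertDeflM72YPmO 1 89 = true := by
  decide +kernel


end Literature.NumberTheory.LFunctions
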